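import Literature.AnabelianGeometry.EtaleTheta.ThetaRigidity
import Literature.AnabelianGeometry.EtaleTheta.Discharge.Sec2IsoLift
import Literature.AnabelianGeometry.EtaleTheta.Discharge.Sec2EnvelopeLemmas

/-!
# [EtTh] §2 discharge: Corollary 2.19 (i) (cyclotomic rigidity) from Cor 2.18 (i), (iii) and
# Prop 2.14 (i) — proof-only companion of `ThetaRigidity.lean`

Mochizuki, *The Étale Theta Function and its Frobenioid-theoretic Manifestations* [EtTh],
Publ. RIMS 45 (2009), §2, Cor 2.19 (i) p.64 (proof pp.65–66), Cor 2.18 (i), (iii) pp.60–61,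
Prop 2.14 (i) p.49 (locators `p.N` = PDF pages of the PRIMS text; bib key `MochizukiEtTh2009`).
PROOF-ONLY companion (no `def`, no new named fact) of `ThetaRigidity.lean` (seat abc-iut-L2-t2;
nothing there is edited or restated); discharge seat abc-iut-L2-d1, DAG node `EtTh:Cor2.19(i)`
(LONG-CHAINS lane C2). The printed proof of Cor 2.19 (i) (p.65): "by applying the
characterization of `(l·Δ_Θ)[μ_N]` given in Proposition 2.14, (i) … the subquotients … may be
constructed group-theoretically: by Corollary 2.18, (iii), we reconstruct `Π•_Y`, `Π•_X`; then by
Corollary 2.18, (i), the subquotients of `Π^tp_X` …; the theta and algebraic sections coincide on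
`Ker(Π•_Y ↠ (Π•_Y)^Θ)` [cf. Proposition 1.3]". Exactly this is kernel-checked here:

* `RigidData.cor219_i_subquotients_of` — **Cor 2.19 (i), subquotients**: the named fact
  `RigidData.Cor219_i_subquotients` HOLDS for every `RigidData` satisfying the named facts
  `Cor218_i` (theta-related subquotients of `Π^tp_X` are characteristic — the anabelian input,
  FACT-policy), `Cor218_iii_quotient` (`Ker(Π• ↠ Π•_Y)` = union of centralisers of open subgroups;
  proved from temp-slimness in `ThetaSystems.lean`) and `Cor218_iii_PiX` (faithfulness of the
  conjugation action of `Π^tp_X` on `Π^tp_Y`, temp-slimness);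
* `RigidData.cor219_i_splittings_of` — **Cor 2.19 (i), the two splittings** (hence the cyclotomic
  rigidity isomorphism `(l·Δ•Θ) ⊗ ℤ/Nℤ ≅ Π•μ`, cf. `RigidData.sAlg_mul_sTheta_inv`): the named fact
  `RigidData.Cor219_i_splittings` HOLDS under the same three facts plus `Prop214_i` (the
  characterization "`{γ(β)·β⁻¹}`" of the algebraic section over `l·Δ_Θ`).

Mechanism (`Discharge/Sec2IsoLift.lean`): an automorphism `α` of the model `M(η)` preserves
`Ker(Π^tp_Y[μ_N] ↠ Π^tp_Y)` (Cor 2.18 (iii): that kernel is `centralizerUnion`, a topological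
invariant), hence acts on `Π^tp_Y`; `D_Y ↦ D_Y` and temp-slimness extend this action to an
automorphism `γ` of the topological group `Π^tp_X`; Cor 2.18 (i) for `γ` gives the invariance of
`Δ`, `Ker(↠ Θ)`, `l·Δ_Θ`; the theta splitting is pinned by `s^Θ ↦ μ_N`-conjugate of `s^Θ`
(Def 2.13 (ii)) and `μ_N`-conjugation being trivial over `Δ`; the algebraic splitting by
Prop 2.14 (i). HONEST FRAMING: conditional discharge modulo the named facts listed; no side is
taken on [IUTchIII] Cor 3.12; typed ≠ discharged elsewhere.
-/

namespace Literature.AnabelianGeometry.EtaleTheta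

universe u

/-! ## Topological invariance of the union of centralisers of open subgroups -/

/-- An isomorphism of topological groups carries `centralizerUnion` into `centralizerUnion`.
[cite: MochizukiEtTh2009, Prop 2.11(ii) p.44] -/
theorem map_centralizerUnion_le {P Q : Type*} [Group P] [Group Q] [TopologicalSpace P]
    [TopologicalSpace Q] (e : P ≃ₜ* Q) :
    (centralizerUnion P).map e.toMulEquiv.toMonoidHom ≤ centralizerUnion Q := by
  rintro _ ⟨z, ⟨U, hU, hz⟩, rfl⟩
  refine ⟨U.map e.toMulEquiv.toMonoidHom, ?_, ?_⟩
  · rw [Subgroup.coe_map]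
    exact e.toHomeomorph.isOpenMap _ hU
  · rw [Subgroup.mem_centralizer_iff] at hz ⊢
    rintro _ ⟨u, hu, rfl⟩
    change e u * e z = e z * e u
    rw [← map_mul, ← map_mul, hz u hu]

/-- **"Any isomorphism of topological groups is compatible with `Π[μ_N] ↠ Π`"** (Prop 2.11 (ii), in
particular): `centralizerUnion` is carried ONTO `centralizerUnion`.
[cite: MochizukiEtTh2009, Prop 2.11(ii) p.44] -/
theorem map_centralizerUnion_eq {P Q : Type*} [Group P] [Group Q] [TopologicalSpace P]
    [TopologicalSpace Q] (e : P ≃ₜ* Q) :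
    (centralizerUnion P).map e.toMulEquiv.toMonoidHom = centralizerUnion Q := by
  refine le_antisymm (map_centralizerUnion_le e) fun z hz => ?_
  exact ⟨e.symm z, map_centralizerUnion_le e.symm ⟨z, hz, rfl⟩, e.apply_symm_apply z⟩

/-! ## Subgroups of `Π^tp_Y[μ_N]` cut out by a subgroup of `Π^tp_X`, and their invariance -/

namespace ThetaEnvData

variable {N : ℕ+} (T : ThetaEnvData.{u} N)

/-- If `S ↦ S` under `e`, then `S ↦ S` under `e⁻¹`. [cite: MochizukiEtTh2009, Cor 2.19(i) p.64] -/
theorem map_symm_eq_of_map_eq (e : T.env ≃ₜ* T.env) (S : Subgroup T.env)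
    (h : S.map e.toMulEquiv.toMonoidHom = S) : S.map e.symm.toMulEquiv.toMonoidHom = S := by
  conv_lhs => rw [← h, Subgroup.map_map]
  have : e.symm.toMulEquiv.toMonoidHom.comp e.toMulEquiv.toMonoidHom = MonoidHom.id _ :=
    MonoidHom.ext fun x => e.symm_apply_apply x
  rw [this, Subgroup.map_id]

/-- `S ≤ S.map e` once `S.map e⁻¹ ≤ S`. [cite: MochizukiEtTh2009, Cor 2.19(i) p.64] -/
theorem le_map_of_map_symm_le (e : T.env ≃ₜ* T.env) (S : Subgroup T.env)
    (h : S.map e.symm.toMulEquiv.toMonoidHom ≤ S) : S ≤ S.map e.toMulEquiv.toMonoidHom :=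
  fun x hx => ⟨e.symm x, h ⟨x, hx, rfl⟩, e.apply_symm_apply x⟩

/-- The inverse image in `Π^tp_Y[μ_N]` of a subgroup `H ⊆ Π^tp_X` is preserved by any
automorphism `e` of `Π^tp_Y[μ_N]` lying over an automorphism `γ` of `Π^tp_X` with `γ(H) = H`.
[cite: MochizukiEtTh2009, Cor 2.19(i) p.64] -/
theorem map_comap_right_eq (e : T.env ≃* T.env) (γ : T.PiX ≃ₜ* T.PiX)
    (hγ : ∀ x : T.env, ((e x).right : T.PiX) = γ (x.right : T.PiX)) (H : Subgroup T.PiX)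
    (hH : H.map γ.toMulEquiv.toMonoidHom = H) :
    ((H.comap T.PiY.subtype).comap (CycEnvelope.proj T.augY T.chi)).map e.toMonoidHom =
      (H.comap T.PiY.subtype).comap (CycEnvelope.proj T.augY T.chi) := by
  have hmem : ∀ g : T.PiX, γ g ∈ H ↔ g ∈ H := fun g => by
    constructor
    · intro hg
      rw [← hH] at hg
      obtain ⟨g', hg', hgg'⟩ := hg
      rwa [← γ.injective hgg']
    · intro hg
      rw [← hH]
      exact ⟨g, hg, rfl⟩
  ext y
  simp only [Subgroup.mem_map, Subgroup.mem_comap, Subgroup.coe_subtype]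
  constructor
  · rintro ⟨x, hx, rfl⟩
    change ((e x).right : T.PiX) ∈ H
    rwa [hγ, hmem]
  · intro hy
    refine ⟨e.symm y, ?_, e.apply_symm_apply y⟩
    change ((e.symm y).right : T.PiX) ∈ H
    rw [← hmem, ← hγ, MulEquiv.apply_symm_apply]
    exact hy

/-- `Δ^tp_Y[μ_N] = Ker(Π^tp_Y[μ_N] ↠ G_K)` is the inverse image of `Δ_X = Ker(Π^tp_X ↠ G_K)`.
[cite: MochizukiEtTh2009, Def 2.10 p.44] -/
theorem deltaEnv_eq_comap :
    CycEnvelope.deltaEnv T.augY T.chi =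
      (T.aug.ker.comap T.PiY.subtype).comap (CycEnvelope.proj T.augY T.chi) := by
  simp only [MonoidHom.comap_ker]

/-- `μ_N`-conjugation fixes `Δ^tp_Y[μ_N]` pointwise ("`Δ[μ_N] = Δ × Δ_{μ_N}`", Def 2.10).
[cite: MochizukiEtTh2009, Def 2.10 p.44] -/
theorem conj_inMu_apply_of_mem_deltaEnv {x : T.env} (hx : x ∈ CycEnvelope.deltaEnv T.augY T.chi)
    (c : T.mu) : MulAut.conj (CycEnvelope.inMu T.augY T.chi c) x = x := by
  rw [CycEnvelope.mem_deltaEnv_iff, MonoidHom.mem_ker] at hx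
  have hx' : T.aug (x.right : T.PiX) = 1 := hx
  rw [MulAut.conj_apply]
  ext
  · simp [hx']
  · simp

/-- A subgroup of `Δ^tp_Y[μ_N]` is fixed by `μ_N`-conjugation. [cite: MochizukiEtTh2009, Def 2.10 p.44] -/
theorem map_conj_inMu_eq_of_le {S : Subgroup T.env} (hS : S ≤ CycEnvelope.deltaEnv T.augY T.chi)
    (c : T.mu) : S.map (MulAut.conj (CycEnvelope.inMu T.augY T.chi c)).toMonoidHom = S := by
  ext y
  constructor
  · rintro ⟨x, hx, rfl⟩
    change MulAut.conj _ x ∈ S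
    rwa [T.conj_inMu_apply_of_mem_deltaEnv (hS hx)]
  · intro hy
    exact ⟨y, hy, T.conj_inMu_apply_of_mem_deltaEnv (hS hy) c⟩

/-- An isomorphism of model mono-theta environments carries `Im(s^Θ_η)` to a `μ_N`-conjugate
(Def 2.13 (ii): "`s^Θ ↦ s^Θ`" as `μ_N`-conjugacy classes). [cite: MochizukiEtTh2009, Def 2.13(ii) p.48] -/
theorem exists_map_range_sTheta_eq {η : T.PiYdd → T.mu} {hη : η ∈ T.thetaCocycles}
    (α : (T.modelMono hη).Iso (T.modelMono hη)) :
    ∃ c : T.mu, (T.sTheta hη).range.map α.e.toMulEquiv.toMonoidHom =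
      (T.sTheta hη).range.map (MulAut.conj (CycEnvelope.inMu T.augY T.chi c)).toMonoidHom := by
  have h := α.map_sTheta
  change (fun H : Subgroup T.env => H.map α.e.toMulEquiv.toMonoidHom) ''
      CycEnvelope.muConjClass T.augY T.chi (T.sTheta hη).range =
    CycEnvelope.muConjClass T.augY T.chi (T.sTheta hη).range at h
  have : (T.sTheta hη).range.map α.e.toMulEquiv.toMonoidHom ∈
      CycEnvelope.muConjClass T.augY T.chi (T.sTheta hη).range := by
    rw [← h]
    exact ⟨_, CycEnvelope.self_mem_muConjClass T.augY T.chi _, rfl⟩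
  obtain ⟨c, hc⟩ := this
  exact ⟨c, hc⟩

/-- Transport along `e⁻¹` undoes transport along `e` on `Out`. [cite: MochizukiEtTh2009, Def 2.13(ii) p.47] -/
theorem transport_symm_transport {A B : Type*} [Group A] [Group B] [TopologicalSpace A]
    [TopologicalSpace B] (e : A ≃ₜ* B) (d : TopOut A) :
    TopOut.transport e.symm (TopOut.transport e d) = d := by
  obtain ⟨φ, rfl⟩ := QuotientGroup.mk'_surjective _ d
  change TopOut.transport e.symm (TopOut.transport e (TopOut.mk _ φ)) = TopOut.mk _ φ
  rw [transport_mk, transport_mk]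
  congr 1
  apply Subtype.ext
  apply MulEquiv.ext
  intro x
  change e.symm (e (φ.1 (e.symm (e.symm.symm x)))) = φ.1 x
  rw [ContinuousMulEquiv.symm_symm, ContinuousMulEquiv.symm_apply_apply,
    ContinuousMulEquiv.symm_apply_apply]

/-- `D_Y ↦ D_Y` under `α⁻¹` for an isomorphism `α` of model mono-theta environments.
[cite: MochizukiEtTh2009, Def 2.13(ii) p.48] -/
theorem iso_map_D_symm {η η' : T.PiYdd → T.mu} {hη : η ∈ T.thetaCocycles}
    {hη' : η' ∈ T.thetaCocycles} (α : (T.modelMono hη).Iso (T.modelMono hη')) :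
    T.DY.map (TopOut.transport α.e.symm) = T.DY := by
  have h := α.map_D
  change T.DY.map (TopOut.transport α.e) = T.DY at h
  conv_lhs => rw [← h, Subgroup.map_map]
  have : (TopOut.transport α.e.symm).comp (TopOut.transport α.e) = MonoidHom.id _ :=
    MonoidHom.ext fun d => transport_symm_transport α.e d
  rw [this, Subgroup.map_id]

end ThetaEnvData

namespace RigidData

variable {N : ℕ+} {l : ℕ} (R : RigidData.{u} N l)

/-- `s^alg(H ∩ Π^tp_Ÿ) · μ_N` is the inverse image of `H` (for `H ⊆ Π^tp_Ÿ`).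
[cite: MochizukiEtTh2009, Prop 2.14(i) p.49] -/
theorem algImage_sup_ker_eq (H : Subgroup R.PiX) (hH : H ≤ R.PiYdd) :
    R.algImage H ⊔ (CycEnvelope.proj R.augY R.chi).ker =
      (H.comap R.PiY.subtype).comap (CycEnvelope.proj R.augY R.chi) := by
  have h1 : R.algImage H = ((H.subgroupOf R.PiYdd).map R.inclYdd).map
      (CycEnvelope.algSection R.augY R.chi) := by
    rw [Subgroup.map_map]; rfl
  have h2 : (H.subgroupOf R.PiYdd).map R.inclYdd = H.comap R.PiY.subtype := by
    ext p
    simp only [Subgroup.mem_map, Subgroup.mem_subgroupOf, Subgroup.mem_comap,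
      Subgroup.coe_subtype]
    constructor
    · rintro ⟨q, hq, rfl⟩
      exact hq
    · intro hp
      exact ⟨⟨p, hH hp⟩, hp, rfl⟩
  rw [h1, h2, CycEnvelope.map_algSection_sup_ker_proj]

/-- `s^Θ_η(H ∩ Π^tp_Ÿ) = Im(s^Θ_η) ∩ (inverse image of H)`.
[cite: MochizukiEtTh2009, Cor 2.19(i) p.64] -/
theorem thetaImage_eq_range_inf {η : R.PiYdd → R.mu} (hη : η ∈ R.thetaCocycles)
    (H : Subgroup R.PiX) :
    R.thetaImage hη H = (R.toThetaEnvData.sTheta hη).range ⊓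
      (H.comap R.PiY.subtype).comap (CycEnvelope.proj R.augY R.chi) := by
  ext x
  simp only [thetaImage, Subgroup.mem_map, Subgroup.mem_subgroupOf, Subgroup.mem_inf,
    MonoidHom.mem_range, Subgroup.mem_comap, Subgroup.coe_subtype]
  constructor
  · rintro ⟨q, hq, rfl⟩
    exact ⟨⟨q, rfl⟩, hq⟩
  · rintro ⟨⟨q, rfl⟩, hq⟩
    exact ⟨q, hq, rfl⟩

/-- `s^Θ_η(H) ⊆ Δ^tp_Y[μ_N]` for `H ⊆ Δ_X`. [cite: MochizukiEtTh2009, Cor 2.19(i) p.64] -/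
theorem thetaImage_le_deltaEnv {η : R.PiYdd → R.mu} (hη : η ∈ R.thetaCocycles)
    {H : Subgroup R.PiX} (hH : H ≤ R.aug.ker) :
    R.thetaImage hη H ≤ CycEnvelope.deltaEnv R.augY R.chi := by
  rintro _ ⟨q, hq, rfl⟩
  rw [CycEnvelope.mem_deltaEnv_iff, MonoidHom.mem_ker]
  exact hH hq

/-- "The theta and algebraic sections coincide on `Ker(Π•_Y ↠ (Π•_Y)^Θ)`" (p.66): for `H` on which
`η` vanishes, `s^alg(H) = s^Θ_η(H)`. [cite: MochizukiEtTh2009, Cor 2.19(i) p.66] -/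
theorem algImage_eq_thetaImage {η : R.PiYdd → R.mu} (hη : η ∈ R.thetaCocycles)
    (H : Subgroup R.PiX) (hηH : ∀ g : R.PiYdd, (g : R.PiX) ∈ H → η g = 1) :
    R.algImage H = R.thetaImage hη H := by
  ext x
  simp only [algImage, thetaImage, Subgroup.mem_map, Subgroup.mem_subgroupOf]
  refine exists_congr fun q => and_congr_right fun hq => ?_
  have : R.toThetaEnvData.sAlg q = R.toThetaEnvData.sTheta hη q := by
    ext
    · simp [ThetaEnvData.sAlg, ThetaEnvData.sTheta, hηH q hq]
    · rfl
  rw [this]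

/-- **The theta splitting over an invariant subgroup is preserved**: if `α ∈ Aut(M(η))` lies over
`γ ∈ Aut(Π^tp_X)` and `γ(H) = H ⊆ Δ_X`, then `α(s^Θ_η(H)) = s^Θ_η(H)` — because `α(Im s^Θ)` is a
`μ_N`-conjugate of `Im s^Θ` and `μ_N`-conjugation is trivial over `Δ`.
[cite: MochizukiEtTh2009, Cor 2.19(i) p.65] -/
theorem map_thetaImage_eq {η : R.PiYdd → R.mu} {hη : η ∈ R.thetaCocycles}
    (α : (R.modelMono hη).Iso (R.modelMono hη)) (γ : R.PiX ≃ₜ* R.PiX)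
    (hγ : ∀ x : R.env, ((α.e x).right : R.PiX) = γ (x.right : R.PiX))
    (H : Subgroup R.PiX) (hHγ : H.map γ.toMulEquiv.toMonoidHom = H) (hHΔ : H ≤ R.aug.ker) :
    (R.thetaImage hη H).map α.e.toMulEquiv.toMonoidHom = R.thetaImage hη H := by
  obtain ⟨c, hc⟩ := R.toThetaEnvData.exists_map_range_sTheta_eq α
  have hC := R.toThetaEnvData.map_comap_right_eq α.e.toMulEquiv γ hγ H hHγ
  have hC' := R.toThetaEnvData.map_comap_right_eq
    (MulAut.conj (CycEnvelope.inMu R.augY R.chi c)) (ContinuousMulEquiv.refl R.PiX)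
    (fun x => by simp [MulAut.conj_apply]) H (by
      convert Subgroup.map_id H
      exact MonoidHom.ext fun _ => rfl)
  rw [R.thetaImage_eq_range_inf hη H, Subgroup.map_inf_eq _ _ _ α.e.injective, hc, hC]
  conv_lhs => rw [← hC', ← Subgroup.map_inf_eq _ _ _ (MulAut.conj _).injective]
  rw [← R.thetaImage_eq_range_inf hη H]
  exact R.toThetaEnvData.map_conj_inMu_eq_of_le (R.thetaImage_le_deltaEnv hη hHΔ) c

/-- The setting common to both parts of Cor 2.19 (i): from the three Cor 2.18 facts, every
automorphism of `M(η)` lies over an automorphism `γ` of `Π^tp_X` preserving `Δ_X`,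
`Ker(Π^tp_X ↠ (Π^tp_X)^Θ)` and `l·Δ_Θ`. [cite: MochizukiEtTh2009, Cor 2.19(i) p.65] -/
theorem exists_gamma_of_cor218 (h218i : R.Cor218_i) (h218q : R.Cor218_iii_quotient)
    (h218P : R.Cor218_iii_PiX) {η : R.PiYdd → R.mu} {hη : η ∈ R.thetaCocycles}
    (α : (R.modelMono hη).Iso (R.modelMono hη)) :
    ∃ γ : R.PiX ≃ₜ* R.PiX, (∀ x : R.env, ((α.e x).right : R.PiX) = γ (x.right : R.PiX)) ∧
      R.aug.ker.map γ.toMulEquiv.toMonoidHom = R.aug.ker ∧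
      R.thetaKer.map γ.toMulEquiv.toMonoidHom = R.thetaKer ∧
      R.lDeltaTheta.map γ.toMulEquiv.toMonoidHom = R.lDeltaTheta := by
  have hker : ((CycEnvelope.proj R.augY R.chi).ker).map α.e.toMulEquiv.toMonoidHom =
      (CycEnvelope.proj R.augY R.chi).ker := by
    have h := h218q
    unfold Cor218_iii_quotient at h
    rw [← h]
    exact map_centralizerUnion_eq α.e
  obtain ⟨γ, hγ⟩ := ThetaEnvData.exists_continuousMulEquiv_PiX_of_iso α hker h218P
  obtain ⟨-, -, hΔ, hK, hL, -⟩ := h218i γ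
  exact ⟨γ, hγ, hΔ, hK, hL⟩

/-- **Corollary 2.19 (i) (cyclotomic rigidity), subquotients — DISCHARGED modulo Cor 2.18 (i),
(iii)**: every automorphism of the model mono-theta environment `M(η)` preserves
`s^alg(Ker(Π^tp_Ÿ ↠ (Π^tp_Ÿ)^Θ))`, `μ_N · s^alg(l·Δ_Θ)` and `Δ^tp_Y[μ_N]`.
[cite: MochizukiEtTh2009, Cor 2.19(i) p.64] -/
theorem cor219_i_subquotients_of (h218i : R.Cor218_i) (h218q : R.Cor218_iii_quotient)
    (h218P : R.Cor218_iii_PiX) : R.Cor219_i_subquotients := by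
  intro η hη α
  obtain ⟨γ, hγ, hΔ, hK, hL⟩ := R.exists_gamma_of_cor218 h218i h218q h218P α
  refine ⟨?_, ?_, ?_⟩
  · rw [R.algImage_eq_thetaImage hη R.thetaKer (R.cocycle_thetaKer η hη)]
    exact R.map_thetaImage_eq α γ hγ R.thetaKer hK (le_trans R.thetaKer_le inf_le_right)
  · rw [R.algImage_sup_ker_eq R.lDeltaTheta (le_trans R.lDeltaTheta_le inf_le_left)]
    exact R.toThetaEnvData.map_comap_right_eq α.e.toMulEquiv γ hγ R.lDeltaTheta hL
  · rw [R.toThetaEnvData.deltaEnv_eq_comap]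
    exact R.toThetaEnvData.map_comap_right_eq α.e.toMulEquiv γ hγ R.aug.ker hΔ

/-! ## The algebraic splitting, via Proposition 2.14 (i) -/

/-- The `D_Y`-automorphisms "`γ`" of Prop 2.14 (i) are stable under conjugation by any
bi-continuous `e` with `[e] D_Y [e]⁻¹ = D_Y` and `e(Δ^tp_Y[μ_N]) = Δ^tp_Y[μ_N]`.
[cite: MochizukiEtTh2009, Prop 2.14(i) p.49] -/
theorem conjContAut_mem_DYAut (e : R.env ≃ₜ* R.env)
    (hD : R.DY.map (TopOut.transport e) = R.DY)
    (hΔ : (CycEnvelope.deltaEnv R.augY R.chi).map e.toMulEquiv.toMonoidHom =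
      CycEnvelope.deltaEnv R.augY R.chi)
    {φ : MulAut R.env} (hφ : φ ∈ R.DYAut) :
    ∃ hc : φ ∈ contMulAut R.env,
      ((conjContAut e ⟨φ, hc⟩ : contMulAut R.env) : MulAut R.env) ∈ R.DYAut := by
  obtain ⟨hc, hmem, haug⟩ := hφ
  refine ⟨hc, (conjContAut e ⟨φ, hc⟩).2, ?_, fun x => ?_⟩
  · rw [← hD, ← ThetaEnvData.transport_mk]
    exact ⟨_, hmem, rfl⟩
  · rw [ThetaEnvData.conjContAut_apply]
    -- `toG (e (φ (e⁻¹ x))) = toG x` since `φ y · y⁻¹ ∈ Δ[μ_N]` and `e` preserves `Δ[μ_N]`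
    have h1 : φ (e.symm x) * (e.symm x)⁻¹ ∈ CycEnvelope.deltaEnv R.augY R.chi := by
      change _ ∈ (CycEnvelope.toG R.augY R.chi).ker
      rw [MonoidHom.mem_ker, map_mul, map_inv, mul_inv_eq_one]
      exact haug (e.symm x)
    have h2 : e (φ (e.symm x) * (e.symm x)⁻¹) ∈ CycEnvelope.deltaEnv R.augY R.chi := by
      rw [← hΔ]; exact ⟨_, h1, rfl⟩
    rw [map_mul, map_inv, ContinuousMulEquiv.apply_symm_apply] at h2
    change _ ∈ (CycEnvelope.toG R.augY R.chi).ker at h2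
    rw [MonoidHom.mem_ker, map_mul, map_inv, mul_inv_eq_one] at h2
    exact h2

/-- One inclusion of the invariance of the algebraic splitting, for any bi-continuous `e` over
which `D_Y`, `Δ^tp_Y[μ_N]` and `s^alg(Ker(↠Θ))` are invariant (Prop 2.14 (i) characterizes
`s^alg(l·Δ_Θ)` in these terms). [cite: MochizukiEtTh2009, Cor 2.19(i) p.65] -/
theorem map_algImage_lDeltaTheta_le (h214i : R.Prop214_i) (e : R.env ≃ₜ* R.env)
    (hD : R.DY.map (TopOut.transport e) = R.DY)
    (hΔ : (CycEnvelope.deltaEnv R.augY R.chi).map e.toMulEquiv.toMonoidHom =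
      CycEnvelope.deltaEnv R.augY R.chi)
    (hK : (R.algImage R.thetaKer).map e.toMulEquiv.toMonoidHom = R.algImage R.thetaKer) :
    (R.algImage R.lDeltaTheta).map e.toMulEquiv.toMonoidHom ≤ R.algImage R.lDeltaTheta := by
  rintro _ ⟨x, hx, rfl⟩
  obtain ⟨φ, hφ, β, hβ, k, hk, rfl⟩ := (h214i x).mpr hx
  obtain ⟨hc, hψ⟩ := R.conjContAut_mem_DYAut e hD hΔ hφ
  refine (h214i _).mp ⟨_, hψ, e β, ?_, e k, ?_, ?_⟩
  · rw [← hΔ]; exact ⟨β, hβ, rfl⟩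
  · rw [← hK]; exact ⟨k, hk, rfl⟩
  · change e (φ β * β⁻¹ * k) = _
    rw [ThetaEnvData.conjContAut_apply, ContinuousMulEquiv.symm_apply_apply, map_mul, map_mul,
      map_inv]

/-- **Corollary 2.19 (i) (cyclotomic rigidity), the two splittings — DISCHARGED modulo Cor 2.18
(i), (iii) and Prop 2.14 (i)**: every automorphism of the model mono-theta environment `M(η)`
preserves both `s^alg(l·Δ_Θ)` and `s^Θ_η(l·Δ_Θ)` — hence the isomorphism of cyclotomes
`(l·Δ•Θ) ⊗ ℤ/Nℤ ≅ Π•μ` they determine (`RigidData.sAlg_mul_sTheta_inv`).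
[cite: MochizukiEtTh2009, Cor 2.19(i) p.64] -/
theorem cor219_i_splittings_of (h218i : R.Cor218_i) (h218q : R.Cor218_iii_quotient)
    (h218P : R.Cor218_iii_PiX) (h214i : R.Prop214_i) : R.Cor219_i_splittings := by
  intro η hη α
  obtain ⟨γ, hγ, hΔ, hK, hL⟩ := R.exists_gamma_of_cor218 h218i h218q h218P α
  obtain ⟨hK', -, hΔ'⟩ := R.cor219_i_subquotients_of h218i h218q h218P η hη α
  have hD : R.DY.map (TopOut.transport α.e) = R.DY := α.map_D
  refine ⟨le_antisymm (R.map_algImage_lDeltaTheta_le h214i α.e hD hΔ' hK') ?_,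
    R.map_thetaImage_eq α γ hγ R.lDeltaTheta hL (le_trans R.lDeltaTheta_le inf_le_right)⟩
  exact R.toThetaEnvData.le_map_of_map_symm_le α.e _ (R.map_algImage_lDeltaTheta_le h214i
    α.e.symm (R.toThetaEnvData.iso_map_D_symm α) (R.toThetaEnvData.map_symm_eq_of_map_eq α.e _ hΔ')
    (R.toThetaEnvData.map_symm_eq_of_map_eq α.e _ hK'))

end RigidData

end Literature.AnabelianGeometry.EtaleTheta
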